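/-
COR-CM (cell pub-hodgecm2) — RSCONJ («`RecordSystem.conj`», IDENT-LEMMA component (e) «SPACE by construction»), row «e ∕ TRANSFER» of the
RSCONJ lead's filing order (mukey-p6 g1 RULING (3), HOME∕INBOX l.15599): the generic inputs of the assembly `exists_conj_of_complexSide` —
the BASE-CHANGE SWAP `(X ⊗_{L,c} L) ⊗_{L,τ} ℂ ≅ (X ⊗_{L,τ} ℂ) ⊗_{ℂ,conj} ℂ` along `τ ∘ c = conj ∘ τ` (DATA, by `pullback.lift`, natural in `X`),
the point transport `Θ : (X ⊗_{L,c} L)(ℂ)_τ ≃ X(ℂ)_τ` with its Galois equivariance (E), and the point-formula square (P′).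
Author prover-pub-hodgeaudit-ident-2-g0-0 (checker witness, adopted as row A mainline by the lead); filer = the RSCONJ lead.
KERNEL: small definitions by explicit formula (`bcLift`, `uMap`, `phiLeft`, `vMap`, `psiLeft`, `swapIso`, `thetaFun`, `thetaInv`, `theta`) + theorems;
explicit binders (the ring identity `hc : τ.comp c = conj.comp τ` is an explicit hypothesis of every declaration that uses it); no instance,
no named fact, no notation, no `sorry`.  HC_CM is NOT proved; this file discharges no END binder.
-/
import Literature.AlgebraicGeometry.Motives.ConjugatePointsHomeomorph
import Literature.AlgebraicGeometry.ShimuraVarieties.UnitaryBallConjugateDatum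
import HarnessLib

/-!
# RSCONJ transfer data: the base-change swap, the point transport `Θ`, and the point-formula square

For a field `L`, ring maps `c : L →+* L` and `τ : L →+* ℂ` with `τ ∘ c = conj ∘ τ` (for a CM field and its complex conjugation `c`:
Mathlib `IsCMField.complexEmbedding_complexConj`) and an `L`-scheme `X`:

* `swapIso hc X : (X ⊗_{L,c} L) ⊗_{L,τ} ℂ ≅ (X ⊗_{L,τ} ℂ) ⊗_{ℂ,conj} ℂ` — both are `X ×_{Spec L} Spec ℂ` along `Spec(τ ∘ c) = Spec(conj ∘ τ)`
  ([Görtz–Wedhorn I] Prop. 4.16); built from two `pullback.lift`s each way, inverse laws and naturality (`swapIso_natural`) by projection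
  extensionality; `swapIso_inv_left_fst`: `swap⁻¹ ≫ pr_τ ≫ pr_c = pr_conj ≫ pr_τ`.
* `theta hc X : (X ⊗_{L,c} L)(ℂ)_τ ≃ X(ℂ)_τ`, `P ↦ Spec(conj) ≫ P ≫ pr_c` (a `(τ ∘ c)`-point twisted back to a `τ`-point), inverse
  `Q ↦ (Spec(conj) ≫ Q, Spec τ)`; (E) `theta_smul`: `Θ (σ • P) = σ' • Θ P` whenever `σ' z = conj (σ (conj z))` (Hartshorne II Ex. 4.7).
* (P′) `baseChangeEquiv_symm_map_swapIso_inv_toConjugate`: `(swap⁻¹ ∘ toConjugate ∘ (·)_τ)(Q)`, read back in `X ⊗_{L,c} L` over `τ`, is `Θ⁻¹ Q`.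

These are exactly the inputs `e`, `Θ`, `hE`, `hP` of `RecordSystemConjAssembly.exists_conj_of_complexSide` at the conjugate complex record
system `RecordSystemConjComplex.conjComplexRecordSystem` (head file `HComp/RecordSystemConj.lean`).

References: U. Görtz, T. Wedhorn, *Algebraic Geometry I*, Prop. 4.16; R. Hartshorne, *Algebraic Geometry*, II.3 Thm. 3.3, II Ex. 2.7, 4.7;
J. S. Milne, *Introduction to Shimura varieties*, §12 (62).
-/

set_option autoImplicit false

noncomputable section

open CategoryTheory CategoryTheory.Limits AlgebraicGeometry

namespace Summit.HodgeConjecture.CorCM.Model.RecordSystemConj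

namespace Ident2Witness

open Literature.AlgebraicGeometry.Motives
open Literature.AlgebraicGeometry.ShimuraVarieties (conjAut)

/-! ### Base change in the `Over` language: lift, projections, extensionality -/

section BC

variable {k K : Type} [CommRing k] [CommRing K] (σ : k →+* K) (X : SchemeOver k)

/-- The pullback square of `X_σ`: `pr₁ ≫ (X → Spec k) = (X_σ → Spec K) ≫ Spec σ`. [folklore] -/
@[reassoc] theorem bc_condition :
    baseChangeHomFst σ X ≫ X.hom = ((baseChangeHom σ).obj X).hom ≫ Spec.map (CommRingCat.ofHom σ) :=
  pullback.condition

variable {X} in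
/-- The universal map into `X_σ = X ×_{Spec k} Spec K`. [folklore] -/
def bcLift {W : Scheme} (a : W ⟶ X.left) (b : W ⟶ Spec (CommRingCat.of K))
    (w : a ≫ X.hom = b ≫ Spec.map (CommRingCat.ofHom σ)) : W ⟶ ((baseChangeHom σ).obj X).left :=
  pullback.lift a b w

/-- `bcLift ≫ pr₁ = a`. [folklore] -/
@[reassoc (attr := simp)] theorem bcLift_fst {W : Scheme} (a : W ⟶ X.left) (b : W ⟶ Spec (CommRingCat.of K))
    (w : a ≫ X.hom = b ≫ Spec.map (CommRingCat.ofHom σ)) : bcLift σ a b w ≫ baseChangeHomFst σ X = a :=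
  pullback.lift_fst _ _ _

/-- `bcLift ≫ pr₂ = b`. [folklore] -/
@[reassoc (attr := simp)] theorem bcLift_snd {W : Scheme} (a : W ⟶ X.left) (b : W ⟶ Spec (CommRingCat.of K))
    (w : a ≫ X.hom = b ≫ Spec.map (CommRingCat.ofHom σ)) : bcLift σ a b w ≫ ((baseChangeHom σ).obj X).hom = b :=
  pullback.lift_snd _ _ _

variable {X} in
/-- Two maps into `X_σ` agree iff they agree after both projections. [folklore] -/
theorem bc_hom_ext {W : Scheme} {a b : W ⟶ ((baseChangeHom σ).obj X).left}
    (h₁ : a ≫ baseChangeHomFst σ X = b ≫ baseChangeHomFst σ X)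
    (h₂ : a ≫ ((baseChangeHom σ).obj X).hom = b ≫ ((baseChangeHom σ).obj X).hom) : a = b :=
  pullback.hom_ext h₁ h₂

/-- Naturality of the structure maps: `(f_σ) ≫ (Y_σ → Spec K) = (X_σ → Spec K)`. [folklore] -/
@[reassoc] theorem bc_map_left_comp_hom {X Y : SchemeOver k} (f : X ⟶ Y) :
    ((baseChangeHom σ).map f).left ≫ ((baseChangeHom σ).obj Y).hom = ((baseChangeHom σ).obj X).hom :=
  Over.w _

end BC

/-! ### The ring-map identities -/

variable {L : Type} [Field L]

/-- `Spec conj ≫ Spec conj = 𝟙`. [folklore] -/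
theorem specConj_comp_specConj :
    Spec.map (CommRingCat.ofHom (conjAut : ℂ ≃+* ℂ).toRingHom) ≫ Spec.map (CommRingCat.ofHom (conjAut : ℂ ≃+* ℂ).toRingHom) =
      𝟙 _ := by
  rw [← Spec.map_comp, ← CommRingCat.ofHom_comp]
  have : (conjAut : ℂ ≃+* ℂ).toRingHom.comp (conjAut : ℂ ≃+* ℂ).toRingHom = RingHom.id ℂ :=
    RingHom.ext fun z => star_star z
  rw [this, CommRingCat.ofHom_id, Spec.map_id]

variable {cL : L →+* L} {τ : L →+* ℂ}

/-- `Spec τ ≫ Spec c = Spec conj ≫ Spec τ` from `τ ∘ c = conj ∘ τ`. [folklore] -/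
theorem specTau_comp_specC (hc : τ.comp cL = (conjAut : ℂ ≃+* ℂ).toRingHom.comp τ) :
    Spec.map (CommRingCat.ofHom τ) ≫ Spec.map (CommRingCat.ofHom cL) =
      Spec.map (CommRingCat.ofHom (conjAut : ℂ ≃+* ℂ).toRingHom) ≫ Spec.map (CommRingCat.ofHom τ) := by
  rw [← Spec.map_comp, ← Spec.map_comp, ← CommRingCat.ofHom_comp, ← CommRingCat.ofHom_comp, hc]

variable (hc : τ.comp cL = (conjAut : ℂ ≃+* ℂ).toRingHom.comp τ)
include hc

/-! ### The swap isomorphism `(X ⊗_{L,c} L) ⊗_{L,τ} ℂ ≅ (X ⊗_{L,τ} ℂ) ⊗_{ℂ,conj} ℂ` -/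

section Swap

variable (X : SchemeOver L)

/-- `(X ⊗_{L,c} L) ⊗_{L,τ} ℂ ⟶ X ⊗_{L,τ} ℂ`: `(pr₁ ∘ pr₁, Spec conj ∘ pr₂)`. -/
def uMap : ((baseChangeHom τ).obj ((baseChangeHom cL).obj X)).left ⟶ ((baseChangeHom τ).obj X).left :=
  bcLift τ (baseChangeHomFst τ ((baseChangeHom cL).obj X) ≫ baseChangeHomFst cL X)
    (((baseChangeHom τ).obj ((baseChangeHom cL).obj X)).hom ≫ Spec.map (CommRingCat.ofHom (conjAut : ℂ ≃+* ℂ).toRingHom))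
    (by rw [Category.assoc, bc_condition, bc_condition_assoc, Category.assoc, specTau_comp_specC hc])

/-- `u ≫ pr₁ = pr₁ ≫ pr₁`. [folklore] -/
@[reassoc (attr := simp)] theorem uMap_fst :
    uMap hc X ≫ baseChangeHomFst τ X = baseChangeHomFst τ ((baseChangeHom cL).obj X) ≫ baseChangeHomFst cL X :=
  bcLift_fst _ _ _ _ _

/-- `u ≫ pr₂ = pr₂ ≫ Spec conj`. [folklore] -/
@[reassoc (attr := simp)] theorem uMap_snd :
    uMap hc X ≫ ((baseChangeHom τ).obj X).hom =
      ((baseChangeHom τ).obj ((baseChangeHom cL).obj X)).hom ≫ Spec.map (CommRingCat.ofHom (conjAut : ℂ ≃+* ℂ).toRingHom) :=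
  bcLift_snd _ _ _ _ _

/-- `φ : (X ⊗_{L,c} L) ⊗_{L,τ} ℂ ⟶ (X ⊗_{L,τ} ℂ) ⊗_{ℂ,conj} ℂ` on underlying schemes. -/
def phiLeft : ((baseChangeHom τ).obj ((baseChangeHom cL).obj X)).left ⟶
    ((baseChangeHom (conjAut : ℂ ≃+* ℂ).toRingHom).obj ((baseChangeHom τ).obj X)).left :=
  bcLift (conjAut : ℂ ≃+* ℂ).toRingHom (uMap hc X) ((baseChangeHom τ).obj ((baseChangeHom cL).obj X)).hom (uMap_snd hc X)

/-- `φ ≫ pr₁ = u`. [folklore] -/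
@[reassoc (attr := simp)] theorem phiLeft_fst :
    phiLeft hc X ≫ baseChangeHomFst (conjAut : ℂ ≃+* ℂ).toRingHom ((baseChangeHom τ).obj X) = uMap hc X :=
  bcLift_fst _ _ _ _ _

/-- `φ ≫ pr₂ = pr₂`. [folklore] -/
@[reassoc (attr := simp)] theorem phiLeft_snd :
    phiLeft hc X ≫ ((baseChangeHom (conjAut : ℂ ≃+* ℂ).toRingHom).obj ((baseChangeHom τ).obj X)).hom =
      ((baseChangeHom τ).obj ((baseChangeHom cL).obj X)).hom :=
  bcLift_snd _ _ _ _ _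

/-- `(X ⊗_{L,τ} ℂ) ⊗_{ℂ,conj} ℂ ⟶ X ⊗_{L,c} L`: `(pr₁ ∘ pr₁, Spec τ ∘ pr₂)`. -/
def vMap : ((baseChangeHom (conjAut : ℂ ≃+* ℂ).toRingHom).obj ((baseChangeHom τ).obj X)).left ⟶
    ((baseChangeHom cL).obj X).left :=
  bcLift cL (baseChangeHomFst (conjAut : ℂ ≃+* ℂ).toRingHom ((baseChangeHom τ).obj X) ≫ baseChangeHomFst τ X)
    (((baseChangeHom (conjAut : ℂ ≃+* ℂ).toRingHom).obj ((baseChangeHom τ).obj X)).hom ≫ Spec.map (CommRingCat.ofHom τ))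
    (by rw [Category.assoc, bc_condition, bc_condition_assoc, Category.assoc, specTau_comp_specC hc])

/-- `v ≫ pr₁ = pr₁ ≫ pr₁`. [folklore] -/
@[reassoc (attr := simp)] theorem vMap_fst :
    vMap hc X ≫ baseChangeHomFst cL X =
      baseChangeHomFst (conjAut : ℂ ≃+* ℂ).toRingHom ((baseChangeHom τ).obj X) ≫ baseChangeHomFst τ X :=
  bcLift_fst _ _ _ _ _

/-- `v ≫ pr₂ = pr₂ ≫ Spec τ`. [folklore] -/
@[reassoc (attr := simp)] theorem vMap_snd :
    vMap hc X ≫ ((baseChangeHom cL).obj X).hom =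
      ((baseChangeHom (conjAut : ℂ ≃+* ℂ).toRingHom).obj ((baseChangeHom τ).obj X)).hom ≫ Spec.map (CommRingCat.ofHom τ) :=
  bcLift_snd _ _ _ _ _

/-- `ψ : (X ⊗_{L,τ} ℂ) ⊗_{ℂ,conj} ℂ ⟶ (X ⊗_{L,c} L) ⊗_{L,τ} ℂ` on underlying schemes. -/
def psiLeft : ((baseChangeHom (conjAut : ℂ ≃+* ℂ).toRingHom).obj ((baseChangeHom τ).obj X)).left ⟶
    ((baseChangeHom τ).obj ((baseChangeHom cL).obj X)).left :=
  bcLift τ (vMap hc X) ((baseChangeHom (conjAut : ℂ ≃+* ℂ).toRingHom).obj ((baseChangeHom τ).obj X)).hom (vMap_snd hc X)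

/-- `ψ ≫ pr₁ = v`. [folklore] -/
@[reassoc (attr := simp)] theorem psiLeft_fst :
    psiLeft hc X ≫ baseChangeHomFst τ ((baseChangeHom cL).obj X) = vMap hc X :=
  bcLift_fst _ _ _ _ _

/-- `ψ ≫ pr₂ = pr₂`. [folklore] -/
@[reassoc (attr := simp)] theorem psiLeft_snd :
    psiLeft hc X ≫ ((baseChangeHom τ).obj ((baseChangeHom cL).obj X)).hom =
      ((baseChangeHom (conjAut : ℂ ≃+* ℂ).toRingHom).obj ((baseChangeHom τ).obj X)).hom :=
  bcLift_snd _ _ _ _ _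

/-- `φ ≫ ψ = 𝟙` (projection extensionality, twice). [folklore] -/
theorem phiLeft_psiLeft : phiLeft hc X ≫ psiLeft hc X = 𝟙 _ := by
  refine bc_hom_ext τ (bc_hom_ext cL ?_ ?_) ?_
  · simp only [Category.assoc, Category.id_comp, psiLeft_fst_assoc, vMap_fst, phiLeft_fst_assoc, uMap_fst]
  · simp only [Category.assoc, Category.id_comp, bc_condition, psiLeft_snd_assoc, phiLeft_snd_assoc]
  · simp only [Category.assoc, Category.id_comp, psiLeft_snd, phiLeft_snd]

/-- `ψ ≫ φ = 𝟙` (projection extensionality, twice). [folklore] -/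
theorem psiLeft_phiLeft : psiLeft hc X ≫ phiLeft hc X = 𝟙 _ := by
  refine bc_hom_ext (conjAut : ℂ ≃+* ℂ).toRingHom (bc_hom_ext τ ?_ ?_) ?_
  · simp only [Category.assoc, Category.id_comp, phiLeft_fst_assoc, uMap_fst, psiLeft_fst_assoc, vMap_fst]
  · simp only [Category.assoc, Category.id_comp, bc_condition, phiLeft_snd_assoc, psiLeft_snd_assoc]
  · simp only [Category.assoc, Category.id_comp, phiLeft_snd, psiLeft_snd]

/-- **The swap isomorphism** `(X ⊗_{L,c} L) ⊗_{L,τ} ℂ ≅ (X ⊗_{L,τ} ℂ) ⊗_{ℂ,conj} ℂ` of `ℂ`-schemes (both are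
`X ×_{Spec L} Spec ℂ` along `Spec(τ ∘ c) = Spec(conj ∘ τ)`). [cite: GortzWedhorn2020, Prop. 4.16] -/
def swapIso : (baseChangeHom τ).obj ((baseChangeHom cL).obj X) ≅
    (baseChangeHom (conjAut : ℂ ≃+* ℂ).toRingHom).obj ((baseChangeHom τ).obj X) :=
  Over.isoMk (Iso.mk (phiLeft hc X) (psiLeft hc X) (phiLeft_psiLeft hc X) (psiLeft_phiLeft hc X)) (phiLeft_snd hc X)

/-- Underlying morphism of the swap (by `rfl`). [folklore] -/
@[simp] theorem swapIso_hom_left : (swapIso hc X).hom.left = phiLeft hc X := rfl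
/-- Underlying morphism of the inverse swap (by `rfl`). [folklore] -/
@[simp] theorem swapIso_inv_left : (swapIso hc X).inv.left = psiLeft hc X := rfl

/-- The inverse swap composed with the two projections to `X` is the pair of projections on the other side. -/
@[reassoc] theorem swapIso_inv_left_fst :
    (swapIso hc X).inv.left ≫ baseChangeHomFst τ ((baseChangeHom cL).obj X) ≫ baseChangeHomFst cL X =
      baseChangeHomFst (conjAut : ℂ ≃+* ℂ).toRingHom ((baseChangeHom τ).obj X) ≫ baseChangeHomFst τ X := by
  rw [swapIso_inv_left, psiLeft_fst_assoc, vMap_fst]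

variable {X}

/-- Naturality of the swap in `X`. -/
theorem swapIso_natural {X Y : SchemeOver L} (g : X ⟶ Y) :
    (baseChangeHom τ).map ((baseChangeHom cL).map g) ≫ (swapIso hc Y).hom =
      (swapIso hc X).hom ≫ (baseChangeHom (conjAut : ℂ ≃+* ℂ).toRingHom).map ((baseChangeHom τ).map g) := by
  ext : 1
  rw [Over.comp_left, Over.comp_left, swapIso_hom_left, swapIso_hom_left]
  refine bc_hom_ext (conjAut : ℂ ≃+* ℂ).toRingHom (bc_hom_ext τ ?_ ?_) ?_
  · simp only [Category.assoc, phiLeft_fst_assoc, uMap_fst_assoc, uMap_fst, baseChangeHom_map_left_comp_fst_assoc,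
      baseChangeHom_map_left_comp_fst]
  · simp only [Category.assoc, phiLeft_fst_assoc, uMap_snd, bc_map_left_comp_hom_assoc,
      bc_map_left_comp_hom, baseChangeHom_map_left_comp_fst_assoc]
  · simp only [Category.assoc, phiLeft_snd, bc_map_left_comp_hom]

end Swap

/-! ### `Θ`: complex points of `X ⊗_{L,c} L` (over `τ`) vs complex points of `X` (over `τ`) -/

section Theta

variable (X : SchemeOver L)

omit hc in
/-- `(σ • P) = Spec σ ≫ P` on underlying morphisms (the tree's `AlgPoints.smul_left`, `toSpecHom` form). [folklore] -/
theorem toSpecHom_smul {Y : SchemeOver L} (σ : letI := τ.toAlgebra; ℂ ≃ₐ[L] ℂ) (P : letI := τ.toAlgebra; ComplexPoints Y) :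
    (letI := τ.toAlgebra; (σ • P).toSpecHom) =
      Spec.map (CommRingCat.ofHom (letI := τ.toAlgebra; (σ : ℂ →+* ℂ))) ≫ (letI := τ.toAlgebra; P.toSpecHom) :=
  rfl

/-- `Θ P := Spec(conj) ≫ P ≫ pr₁`, a `τ`-point of `X` (`P ≫ pr₁` is a `(τ ∘ c)`-point, `τ ∘ c = conj ∘ τ`). -/
def thetaFun (P : letI := τ.toAlgebra; ComplexPoints ((baseChangeHom cL).obj X)) : letI := τ.toAlgebra; ComplexPoints X :=
  letI := τ.toAlgebra
  AlgPoints.mk (Spec.map (CommRingCat.ofHom (conjAut : ℂ ≃+* ℂ).toRingHom) ≫ P.toSpecHom ≫ baseChangeHomFst cL X) (by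
    have w : P.toSpecHom ≫ ((baseChangeHom cL).obj X).hom = Spec.map (CommRingCat.ofHom τ) := Over.w P
    show _ = Spec.map (CommRingCat.ofHom τ)
    rw [Category.assoc, Category.assoc, bc_condition, reassoc_of% w, specTau_comp_specC hc, ← Category.assoc,
      specConj_comp_specConj, Category.id_comp])

/-- `Θ⁻¹ Q := (Spec(conj) ≫ Q, Spec τ)`, a `τ`-point of `X ⊗_{L,c} L`. -/
def thetaInv (Q : letI := τ.toAlgebra; ComplexPoints X) : letI := τ.toAlgebra; ComplexPoints ((baseChangeHom cL).obj X) :=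
  letI := τ.toAlgebra
  AlgPoints.mk (bcLift cL (Spec.map (CommRingCat.ofHom (conjAut : ℂ ≃+* ℂ).toRingHom) ≫ Q.toSpecHom)
    (Spec.map (CommRingCat.ofHom τ)) (by
      have w : Q.toSpecHom ≫ X.hom = Spec.map (CommRingCat.ofHom τ) := Over.w Q
      rw [Category.assoc, w, specTau_comp_specC hc])) (by
    show _ = Spec.map (CommRingCat.ofHom τ)
    exact bcLift_snd _ _ _ _ _)

/-- Underlying morphism of `Θ P` (by `rfl`). [folklore] -/
@[reassoc] theorem toSpecHom_thetaFun (P : letI := τ.toAlgebra; ComplexPoints ((baseChangeHom cL).obj X)) :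
    (letI := τ.toAlgebra; (thetaFun hc X P).toSpecHom) =
      Spec.map (CommRingCat.ofHom (conjAut : ℂ ≃+* ℂ).toRingHom) ≫ (letI := τ.toAlgebra; P.toSpecHom) ≫ baseChangeHomFst cL X :=
  rfl

/-- `Θ⁻¹ Q ≫ pr_c = Spec conj ≫ Q`. [folklore] -/
@[reassoc] theorem toSpecHom_thetaInv_fst (Q : letI := τ.toAlgebra; ComplexPoints X) :
    (letI := τ.toAlgebra; (thetaInv hc X Q).toSpecHom) ≫ baseChangeHomFst cL X =
      Spec.map (CommRingCat.ofHom (conjAut : ℂ ≃+* ℂ).toRingHom) ≫ (letI := τ.toAlgebra; Q.toSpecHom) :=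
  bcLift_fst _ _ _ _ _

/-- `Θ⁻¹ Q ≫ pr₂ = Spec τ`. [folklore] -/
@[reassoc] theorem toSpecHom_thetaInv_snd (Q : letI := τ.toAlgebra; ComplexPoints X) :
    (letI := τ.toAlgebra; (thetaInv hc X Q).toSpecHom) ≫ ((baseChangeHom cL).obj X).hom = Spec.map (CommRingCat.ofHom τ) :=
  bcLift_snd _ _ _ _ _

/-- **`Θ`**: `(X ⊗_{L,c} L)(ℂ)_τ ≃ X(ℂ)_τ`. [folklore] -/
def theta : (letI := τ.toAlgebra; ComplexPoints ((baseChangeHom cL).obj X)) ≃ (letI := τ.toAlgebra; ComplexPoints X) where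
  toFun := thetaFun hc X
  invFun := thetaInv hc X
  left_inv P := by
    letI := τ.toAlgebra
    ext : 1
    change (thetaInv hc X (thetaFun hc X P)).toSpecHom = P.toSpecHom
    refine bc_hom_ext cL ?_ ?_
    · rw [toSpecHom_thetaInv_fst, toSpecHom_thetaFun, ← Category.assoc, ← Category.assoc, specConj_comp_specConj,
        Category.id_comp]
    · rw [toSpecHom_thetaInv_snd]; exact (Over.w P).symm
  right_inv Q := by
    letI := τ.toAlgebra
    ext : 1
    change (thetaFun hc X (thetaInv hc X Q)).toSpecHom = Q.toSpecHom
    rw [toSpecHom_thetaFun, toSpecHom_thetaInv_fst, ← Category.assoc, specConj_comp_specConj, Category.id_comp]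

/-- `theta` is `thetaFun` (by `rfl`). [folklore] -/
theorem theta_apply (P : letI := τ.toAlgebra; ComplexPoints ((baseChangeHom cL).obj X)) :
    theta hc X P = thetaFun hc X P := rfl

/-- `theta⁻¹` is `thetaInv` (by `rfl`). [folklore] -/
theorem theta_symm_apply (Q : letI := τ.toAlgebra; ComplexPoints X) :
    (theta hc X).symm Q = thetaInv hc X Q := rfl

/-- **(E) for `Θ`**: `Θ (σ • P) = σ' • Θ P` for the conjugated automorphism `σ' = conj ∘ σ ∘ conj`, given as an explicit
ring-map hypothesis so that this generic file does not depend on the FRAME's `conjAlgEquiv`. [folklore] -/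
theorem theta_smul (σ σ' : letI := τ.toAlgebra; ℂ ≃ₐ[L] ℂ)
    (hσ' : ∀ z : ℂ, (letI := τ.toAlgebra; σ' z) = starRingEnd ℂ (letI := τ.toAlgebra; σ (starRingEnd ℂ z)))
    (P : letI := τ.toAlgebra; ComplexPoints ((baseChangeHom cL).obj X)) :
    (letI := τ.toAlgebra; theta hc X (σ • P)) = (letI := τ.toAlgebra; σ' • theta hc X P) := by
  letI := τ.toAlgebra
  ext : 1
  change (thetaFun hc X (σ • P)).toSpecHom = (σ' • thetaFun hc X P).toSpecHom
  rw [toSpecHom_smul, toSpecHom_thetaFun, toSpecHom_thetaFun, toSpecHom_smul, ← Category.assoc, ← Category.assoc,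
    ← Category.assoc (Spec.map _) (Spec.map _), ← Spec.map_comp, ← Spec.map_comp, ← CommRingCat.ofHom_comp,
    ← CommRingCat.ofHom_comp]
  have key : (conjAut : ℂ ≃+* ℂ).toRingHom.comp (σ : ℂ →+* ℂ) = (σ' : ℂ →+* ℂ).comp (conjAut : ℂ ≃+* ℂ).toRingHom := by
    refine RingHom.ext fun z => ?_
    change starRingEnd ℂ (σ z) = σ' (starRingEnd ℂ z)
    rw [hσ', starRingEnd_self_apply]
  rw [key, Category.assoc]

end Theta

/-! ### (P′) for the pair `(swapIso, Θ)`: the point formula square, generically -/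

section PointFormula

variable (X : SchemeOver L)

/-- **(P′)**: `((swap⁻¹) ∘ toConjugate ∘ (·)_τ) (Q)`, read back in `X ⊗_{L,c} L` over `τ`, is `Θ⁻¹ Q`. [folklore] -/
theorem baseChangeEquiv_symm_map_swapIso_inv_toConjugate (Q : letI := τ.toAlgebra; ComplexPoints X) :
    (letI := τ.toAlgebra;
      (AlgPoints.baseChangeEquiv τ ((baseChangeHom cL).obj X)).symm
        (AlgPoints.map (swapIso hc X).inv
          (AlgPoints.toConjugate conjAut ((baseChangeHom τ).obj X) (AlgPoints.baseChangeEquiv τ X Q)))) =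
      (theta hc X).symm Q := by
  letI := τ.toAlgebra
  have h1 : ((AlgPoints.baseChangeEquiv τ ((baseChangeHom cL).obj X)).symm (AlgPoints.map (swapIso hc X).inv
      (AlgPoints.toConjugate conjAut ((baseChangeHom τ).obj X) (AlgPoints.baseChangeEquiv τ X Q)))).toSpecHom =
      (AlgPoints.map (swapIso hc X).inv
        (AlgPoints.toConjugate conjAut ((baseChangeHom τ).obj X) (AlgPoints.baseChangeEquiv τ X Q))).toSpecHom ≫
        baseChangeHomFst τ ((baseChangeHom cL).obj X) :=
    AlgPoints.baseChangeEquiv_symm_apply_left τ _ _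
  have h2 : (AlgPoints.map (swapIso hc X).inv
      (AlgPoints.toConjugate conjAut ((baseChangeHom τ).obj X) (AlgPoints.baseChangeEquiv τ X Q))).toSpecHom =
      CategoryStruct.comp (Y := ((baseChangeHom (conjAut : ℂ ≃+* ℂ).toRingHom).obj ((baseChangeHom τ).obj X)).left)
        (AlgPoints.toConjugate conjAut ((baseChangeHom τ).obj X) (AlgPoints.baseChangeEquiv τ X Q)).toSpecHom
        (psiLeft hc X) := rfl
  have h3 : CategoryStruct.comp (Y := ((baseChangeHom (conjAut : ℂ ≃+* ℂ).toRingHom).obj ((baseChangeHom τ).obj X)).left)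
      (AlgPoints.toConjugate conjAut ((baseChangeHom τ).obj X) (AlgPoints.baseChangeEquiv τ X Q)).toSpecHom
      (baseChangeHomFst (conjAut : ℂ ≃+* ℂ).toRingHom ((baseChangeHom τ).obj X)) =
      Spec.map (CommRingCat.ofHom (conjAut : ℂ ≃+* ℂ).toRingHom) ≫ (AlgPoints.baseChangeEquiv τ X Q).toSpecHom :=
    AlgPoints.toSpecHom_toConjugate_comp_conjFst _
  have h4 : (AlgPoints.baseChangeEquiv τ X Q).toSpecHom ≫ baseChangeHomFst τ X = Q.toSpecHom :=
    AlgPoints.baseChangeEquiv_apply_left_comp_fst τ X Q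
  ext : 1
  change ((AlgPoints.baseChangeEquiv τ ((baseChangeHom cL).obj X)).symm (AlgPoints.map (swapIso hc X).inv
      (AlgPoints.toConjugate conjAut ((baseChangeHom τ).obj X) (AlgPoints.baseChangeEquiv τ X Q)))).toSpecHom =
    (thetaInv hc X Q).toSpecHom
  refine bc_hom_ext cL ?_ ?_
  · rw [h1, h2, Category.assoc, Category.assoc, psiLeft_fst_assoc, vMap_fst, ← Category.assoc, h3, Category.assoc, h4,
      toSpecHom_thetaInv_fst]
  · exact (Over.w _).trans (Over.w _).symm

end PointFormula

end Ident2Witness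

end Summit.HodgeConjecture.CorCM.Model.RecordSystemConj

end
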